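import Mathlib
import HarnessLib
import Summits.BirchSwinnertonDyer.BirchSwinnertonDyer.Theses.ManinLocalTwoThree
import Summits.BirchSwinnertonDyer.BirchSwinnertonDyer.Theorems.ManinLocalTwoThreeCDivisionIntegralCDT
import Literature.NumberTheory.Automorphic.UnboundedDenominators

/-!
# Lines/cdivision_udc_int_candidate.lean — (p2 gen 21 for the C2 chain, 2026-08-30): C2 `ManinOddAtFour` ⟸ CDT THEOREM 1 VERBATIM (ℤ-coefficients) ∧ E-an-152c.
# Same line as LEAD's `Lines/cdivision_udc.lean` v2 (TWO stubs), with the printed stub WEAKENED from the Remark-58/59 generalisation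
# `CalegariDimitrovTang2025_unboundedDenominators_algInt` to the paper's Theorem 1 as printed, `CalegariDimitrovTang2025_unboundedDenominators`
# (`f ∈ ℤ⟦q^{1/N}⟧`): the `c`-division witness has RATIONAL-INTEGER `q`-coefficients (kernel theorem `CDivisionInt.exists_cDivisionWitnessInt`); the law stub
# E-an-152c is an g45's row `CDivisionNeron.ShimuraIndexNeFourAtFourOddSquarefree` BY NAME (body identical to v2's `stub_shimuraIndexNeFourAtFourOddSquarefree`);
# composition `CDivisionInt.maninOddAtFour_of_CDTInt_of_indexNeFourOddSquarefree`.  The old printed stub implies the new one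
# (`Literature.NumberTheory.Automorphic.CalegariDimitrovTang2025_unboundedDenominators_of_algInt`).
# HONEST FRAMING: CONDITIONAL reduction; CDT Theorem 1 is printed, statement-only in the tree; E-an-152c OPEN (one-additive-prime levels N = 2^a·m, m odd squarefree,
# cuspidal-inertia 2-rank ≥ 2; the index-4 world); BSD is not proved; Manin's conjecture is not proved.
-/

set_option autoImplicit false
set_option linter.dupNamespace false

noncomputable section

open Literature.NumberTheory.EllipticCurves Literature.NumberTheory.EllipticCurves.ModularForms

namespace Summit.BirchSwinnertonDyer.BirchSwinnertonDyer.Cruxes.ManinOddAtFour.CDivisionUDCInt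

/-- STUB (PRINTED) CDT Theorem 1 — Calegari–Dimitrov–Tang 2025, Thm. 1.0.1 VERBATIM (rational-integer coefficients), the vendored statement-only fact
`Literature.NumberTheory.Automorphic.CalegariDimitrovTang2025_unboundedDenominators`; CITE-ONLY. [cite: CalegariDimitrovTang2025, Thm. 1.0.1] -/
theorem stub_CDT : Literature.NumberTheory.Automorphic.CalegariDimitrovTang2025_unboundedDenominators := by
  sorry

/-- STUB (LAW) E-an-152c `ShimuraIndexNeFourAtFourOddSquarefree` (an g45's row BY NAME, `…Theorems.ManinLocalTwoThreeCDivisionNeronPeriodsConsumers`): no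
lattice-optimal `X₀(N)`-datum at `4 ∣ N` with NO odd square dividing `N` has `Λ₁(f) = 2Λ₀(f)`.  OPEN where the cuspidal-inertia group has 2-rank ≥ 2. -/
theorem stub_shimuraIndexNeFourAtFourOddSquarefree :
    Summit.BirchSwinnertonDyer.BirchSwinnertonDyer.Theorems.ManinLocalTwoThree.CDivisionNeron.ShimuraIndexNeFourAtFourOddSquarefree := by
  sorry

/-- COMPOSITION (no sorry): `CDivisionInt.maninOddAtFour_of_CDTInt_of_indexNeFourOddSquarefree` (p2 g21). -/
theorem ManinOddAtFour_of :
    Summit.BirchSwinnertonDyer.BirchSwinnertonDyer.Theses.ManinLocalTwoThree.ManinOddAtFour :=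
  Summit.BirchSwinnertonDyer.BirchSwinnertonDyer.Theorems.ManinLocalTwoThree.CDivisionInt.maninOddAtFour_of_CDTInt_of_indexNeFourOddSquarefree
    stub_CDT stub_shimuraIndexNeFourAtFourOddSquarefree

end Summit.BirchSwinnertonDyer.BirchSwinnertonDyer.Cruxes.ManinOddAtFour.CDivisionUDCInt

end
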